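import Mathlib.Topology.MetricSpace.ProperSpace
import Literature.Geometry.Lorentzian.Basic
import Literature.Geometry.Lorentzian.CoordScalarCurvatureEvolution
import HarnessLib

/-!
# Crux `GapExhaustion` (stmt-FinalStateConjecture-10808), line `photon-shell-pseudoconvexity`:
# stub (T-C) `stub_hessMarginStableLin` — `C¹`-stability of a Hessian margin on null tangent
# vectors under a perturbed linear constraint

Route `BartnikGapSettling`; helper (`--supports stmt-FinalStateConjecture-10808`) landing the
registered sub-stub (T-C) of the `T`-conditional pseudo-convexity input (line lead c7): the
companion of (C) `stub_hessMarginStable` (p123608) in which the margin is only assumed, and only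
concluded, on vectors satisfying ONE MORE linear constraint `G x e w = 0` — orthogonality to a
conditioning vector `e` (Ionescu–Klainerman's `T`-conditional pseudo-convexity, Invent. Math. 175
(2009), §3.1, condition (HoCond2), with `e = T`). The conclusion is stable under `δ`-perturbation
of the `1`-jet of the components `G` at the point AND of the conditioning vector (`‖e' − e‖ ≤ δ`),
which is what a perturbative (near-Kerr) Carleman argument consumes.

Proof: the same as (C) — by homogeneity reduce to unit vectors; for each `(x, v)` in the compact
`S × sphere` the implication "three constraints ⇒ jet functional `≤ −μ`" holds on a neighbourhood
of `((x, v), 0)` in (point, direction, jet-and-vector perturbation) space (either all three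
constraints hold at the centre, where the margin is strict, or one fails and keeps failing nearby),
and the generalised tube lemma gives a uniform `δ`.
-/

noncomputable section

-- instance search through the nested operator types `E4 →L[ℝ] E4 →L[ℝ] E4 →L[ℝ] ℝ`
set_option maxSynthPendingDepth 3

-- D-0017: single-problem summit, `Summit.<S>.<S>.…` by design (cf. lakefile `weak.linter.dupNamespace`).
set_option linter.dupNamespace false

namespace Summit.FinalStateConjecture.FinalStateConjecture.Theorems

open Set Filter
open Literature.Geometry.Lorentzian Literature.Geometry.Lorentzian.MetricCoord
open scoped Topology

/-- Generalised tube lemma: a property of `(z, p)` holding near `(z, 0)` for every `z` in a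
compact set `K` holds for all `z ∈ K` and all `‖p‖ ≤ δ`, for some uniform `δ > 0`. [folklore] -/
private theorem hessMarginStableLin_tube {X P : Type*} [TopologicalSpace X]
    [SeminormedAddCommGroup P] {K : Set X} (hK : IsCompact K) {good : X × P → Prop}
    (h : ∀ z ∈ K, ∀ᶠ q in 𝓝 (z, (0 : P)), good q) :
    ∃ δ : ℝ, 0 < δ ∧ ∀ z ∈ K, ∀ p : P, ‖p‖ ≤ δ → good (z, p) := by
  have hmem : {q | good q} ∈ (𝓝ˢ K) ×ˢ 𝓝 (0 : P) :=
    hK.mem_nhdsSet_prod_of_forall fun z hz => by rw [← nhds_prod_eq]; exact h z hz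
  obtain ⟨A, hA, B, hB, hAB⟩ := Filter.mem_prod_iff.1 hmem
  obtain ⟨ε, hε, hεB⟩ := Metric.mem_nhds_iff.1 hB
  refine ⟨ε / 2, half_pos hε, fun z hz p hp =>
    hAB (mk_mem_prod (subset_of_mem_nhdsSet hA hz) ?_)⟩
  exact hεB (mem_ball_zero_iff.2 (hp.trans_lt (half_lt_self hε)))

/-- The local step: at a point `x` of the open set `U` (where `G₀` is `C¹`, `f` is `C²` and
`G₀ x` is invertible) and a direction `v` at which the strict margin holds whenever `v` is
`G₀ x`-null, tangent to the level set of `f` and `G₀ x`-orthogonal to `e`, the implication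
"null, tangent and orthogonal to the perturbed vector ⇒ jet functional `≤ -μ`" holds for all
nearby points, directions and all small perturbations `((p.2.1.1, p.2.1.2), p.2.2)` of the 1-jet
`(G₀, DG₀)` and of the conditioning vector `e`. [folklore] -/
private theorem hessMarginStableLin_eventually
    {G₀ : E4 → E4 →L[ℝ] E4 →L[ℝ] ℝ} {f : E4 → ℝ} {e : E4} {U : Set E4} {μ : ℝ} (hU : IsOpen U)
    (hG₀ : ContDiffOn ℝ 1 G₀ U) (hf : ContDiffOn ℝ 2 f U) {x : E4} (hx : x ∈ U)
    (hi : (G₀ x).IsInvertible) (v : E4)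
    (hxv : G₀ x v v = 0 → fderiv ℝ f x v = 0 → G₀ x e v = 0 → hessAt G₀ f x v v < -μ) :
    ∀ᶠ p in 𝓝 (((x, v), 0) : (E4 × E4) ×
          (((E4 →L[ℝ] E4 →L[ℝ] ℝ) × (E4 →L[ℝ] E4 →L[ℝ] E4 →L[ℝ] ℝ)) × E4)),
      (G₀ p.1.1 + p.2.1.1) p.1.2 p.1.2 = 0 → fderiv ℝ f p.1.1 p.1.2 = 0 →
      (G₀ p.1.1 + p.2.1.1) (e + p.2.2) p.1.2 = 0 →
      fderiv ℝ (fderiv ℝ f) p.1.1 p.1.2 p.1.2 - fderiv ℝ f p.1.1 ((2⁻¹ : ℝ) •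
        (G₀ p.1.1 + p.2.1.1).inverse (koszulOp (fderiv ℝ G₀ p.1.1 + p.2.1.2) p.1.2 p.1.2))
          ≤ -μ := by
  have hxU : U ∈ 𝓝 x := hU.mem_nhds hx
  -- continuity of the jets of `G₀` and `f` at `x`
  have hcG : ContinuousAt G₀ x := hG₀.continuousOn.continuousAt hxU
  have hcdG : ContinuousAt (fderiv ℝ G₀) x :=
    (hG₀.continuousOn_fderiv_of_isOpen hU le_rfl).continuousAt hxU
  have hcdf : ContinuousAt (fderiv ℝ f) x :=
    (hf.continuousOn_fderiv_of_isOpen hU (by norm_num)).continuousAt hxU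
  have hcddf : ContinuousAt (fderiv ℝ (fderiv ℝ f)) x :=
    ((hf.fderiv_of_isOpen hU (m := 1) (by norm_num)).continuousOn_fderiv_of_isOpen hU
      le_rfl).continuousAt hxU
  -- the coordinate projections of the parameter space
  have h11 : Continuous fun p : (E4 × E4) ×
        (((E4 →L[ℝ] E4 →L[ℝ] ℝ) × (E4 →L[ℝ] E4 →L[ℝ] E4 →L[ℝ] ℝ)) × E4) =>
      p.1.1 := continuous_fst.comp continuous_fst
  have h12 : Continuous fun p : (E4 × E4) ×
        (((E4 →L[ℝ] E4 →L[ℝ] ℝ) × (E4 →L[ℝ] E4 →L[ℝ] E4 →L[ℝ] ℝ)) × E4) =>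
      p.1.2 := continuous_snd.comp continuous_fst
  have h211 : Continuous fun p : (E4 × E4) ×
        (((E4 →L[ℝ] E4 →L[ℝ] ℝ) × (E4 →L[ℝ] E4 →L[ℝ] E4 →L[ℝ] ℝ)) × E4) =>
      p.2.1.1 :=
    continuous_fst.comp (continuous_fst.comp continuous_snd)
  have h212 : Continuous fun p : (E4 × E4) ×
        (((E4 →L[ℝ] E4 →L[ℝ] ℝ) × (E4 →L[ℝ] E4 →L[ℝ] E4 →L[ℝ] ℝ)) × E4) =>
      p.2.1.2 :=
    continuous_snd.comp (continuous_fst.comp continuous_snd)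
  have h22 : Continuous fun p : (E4 × E4) ×
        (((E4 →L[ℝ] E4 →L[ℝ] ℝ) × (E4 →L[ℝ] E4 →L[ℝ] E4 →L[ℝ] ℝ)) × E4) =>
      p.2.2 := continuous_snd.comp continuous_snd
  -- continuity of the pieces of the jet functional at `p₀ = ((x, v), 0)`
  have hA : ContinuousAt (fun p : (E4 × E4) ×
        (((E4 →L[ℝ] E4 →L[ℝ] ℝ) × (E4 →L[ℝ] E4 →L[ℝ] E4 →L[ℝ] ℝ)) × E4) =>
      G₀ p.1.1 + p.2.1.1) ((x, v), 0) :=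
    (hcG.comp h11.continuousAt).add h211.continuousAt
  have hB : ContinuousAt (fun p : (E4 × E4) ×
        (((E4 →L[ℝ] E4 →L[ℝ] ℝ) × (E4 →L[ℝ] E4 →L[ℝ] E4 →L[ℝ] ℝ)) × E4) =>
      fderiv ℝ f p.1.1) ((x, v), 0) :=
    hcdf.comp h11.continuousAt
  have hC : ContinuousAt (fun p : (E4 × E4) ×
        (((E4 →L[ℝ] E4 →L[ℝ] ℝ) × (E4 →L[ℝ] E4 →L[ℝ] E4 →L[ℝ] ℝ)) × E4) =>
      fderiv ℝ (fderiv ℝ f) p.1.1 p.1.2 p.1.2) ((x, v), 0) :=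
    ((hcddf.comp h11.continuousAt).clm_apply h12.continuousAt).clm_apply h12.continuousAt
  have hD : ContinuousAt (fun p : (E4 × E4) ×
        (((E4 →L[ℝ] E4 →L[ℝ] ℝ) × (E4 →L[ℝ] E4 →L[ℝ] E4 →L[ℝ] ℝ)) × E4) =>
      (G₀ p.1.1 + p.2.1.1).inverse) ((x, v), 0) := by
    refine ContinuousAt.comp_of_eq (hi.contDiffAt_map_inverse (n := 0)).continuousAt hA ?_
    simp
  have hE : ContinuousAt (fun p : (E4 × E4) ×
        (((E4 →L[ℝ] E4 →L[ℝ] ℝ) × (E4 →L[ℝ] E4 →L[ℝ] E4 →L[ℝ] ℝ)) × E4) =>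
        koszulOp (fderiv ℝ G₀ p.1.1 + p.2.1.2) p.1.2 p.1.2) ((x, v), 0) :=
    ((koszulOp.continuous.continuousAt.comp
      ((hcdG.comp h11.continuousAt).add h212.continuousAt)).clm_apply
        h12.continuousAt).clm_apply h12.continuousAt
  have hΦ : ContinuousAt (fun p : (E4 × E4) ×
        (((E4 →L[ℝ] E4 →L[ℝ] ℝ) × (E4 →L[ℝ] E4 →L[ℝ] E4 →L[ℝ] ℝ)) × E4) =>
      fderiv ℝ (fderiv ℝ f) p.1.1 p.1.2 p.1.2 - fderiv ℝ f p.1.1 ((2⁻¹ : ℝ) •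
        (G₀ p.1.1 + p.2.1.1).inverse (koszulOp (fderiv ℝ G₀ p.1.1 + p.2.1.2) p.1.2 p.1.2)))
      ((x, v), 0) :=
    hC.sub (hB.clm_apply ((hD.clm_apply hE).const_smul (2⁻¹ : ℝ)))
  have hα : ContinuousAt (fun p : (E4 × E4) ×
        (((E4 →L[ℝ] E4 →L[ℝ] ℝ) × (E4 →L[ℝ] E4 →L[ℝ] E4 →L[ℝ] ℝ)) × E4) =>
      (G₀ p.1.1 + p.2.1.1) p.1.2 p.1.2)
      ((x, v), 0) :=
    (hA.clm_apply h12.continuousAt).clm_apply h12.continuousAt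
  have hβ : ContinuousAt (fun p : (E4 × E4) ×
        (((E4 →L[ℝ] E4 →L[ℝ] ℝ) × (E4 →L[ℝ] E4 →L[ℝ] E4 →L[ℝ] ℝ)) × E4) =>
      fderiv ℝ f p.1.1 p.1.2) ((x, v), 0) :=
    hB.clm_apply h12.continuousAt
  have hγ : ContinuousAt (fun p : (E4 × E4) ×
        (((E4 →L[ℝ] E4 →L[ℝ] ℝ) × (E4 →L[ℝ] E4 →L[ℝ] E4 →L[ℝ] ℝ)) × E4) =>
      (G₀ p.1.1 + p.2.1.1) (e + p.2.2) p.1.2)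
      ((x, v), 0) :=
    (hA.clm_apply (continuousAt_const.add h22.continuousAt)).clm_apply h12.continuousAt
  by_cases h0 : G₀ x v v = 0 ∧ fderiv ℝ f x v = 0 ∧ G₀ x e v = 0
  · -- strict margin at `p₀`, hence `< -μ` nearby
    have hlt : fderiv ℝ (fderiv ℝ f) x v v - fderiv ℝ f x ((2⁻¹ : ℝ) •
        (G₀ x + 0).inverse (koszulOp (fderiv ℝ G₀ x + 0) v v)) < -μ := by
      rw [add_zero, add_zero]
      have h := hxv h0.1 h0.2.1 h0.2.2
      rwa [hessAt_apply, chrAt_apply] at h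
    filter_upwards [hΦ.eventually_lt continuousAt_const hlt] with p hp _ _ _ using hp.le
  · -- one of the three constraints fails at `p₀`, hence nearby
    rcases not_and_or.1 h0 with h1 | h23
    · have h1' : (G₀ x + 0) v v ≠ 0 := by rwa [add_zero]
      filter_upwards [hα.eventually_ne h1'] with p hp hp1 _ _ using absurd hp1 hp
    · rcases not_and_or.1 h23 with h2 | h3
      · filter_upwards [hβ.eventually_ne h2] with p hp _ hp2 _ using absurd hp2 hp
      · have h3' : (G₀ x + 0) (e + 0) v ≠ 0 := by rwa [add_zero, add_zero]
        filter_upwards [hγ.eventually_ne h3'] with p hp _ _ hp3 using absurd hp3 hp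

/-- **Stub (T-C) of the `T`-conditional pseudo-convexity input (line
`photon-shell-pseudoconvexity`, crux `GapExhaustion`, stmt-FinalStateConjecture-10808) —
`C¹`-stability of a Hessian margin on null tangent vectors under a perturbed linear constraint.**
Let `G₀` be `C¹` and `f` be `C²` on an open neighbourhood of the compact set `S ⊆ E4`, with `G₀ x`
invertible on `S`, and suppose `hessAt G₀ f x w w ≤ -2μ‖w‖²` for all `x ∈ S` and all `w` with
`G₀ x w w = 0`, `Df(x) w = 0` and `G₀ x e w = 0` (`μ > 0`, `e` a fixed conditioning vector). Then
there is `δ > 0` such that for every `x ∈ S`, every field of components `G` with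
`‖G x - G₀ x‖ ≤ δ`, `‖DG(x) - DG₀(x)‖ ≤ δ` and every vector `e'` with `‖e' − e‖ ≤ δ`:
`hessAt G f x w w ≤ -μ‖w‖²` for all `w` with `G x w w = 0`, `Df(x) w = 0`, `G x e' w = 0`.
Compactness of `S × sphere` and continuity of the jet functional and of the three constraints
(Ionescu–Klainerman's condition (HoCond2) is open in the `C¹`-jet of `g` and in `T`). [folklore] -/
theorem stub_hessMarginStableLin :
    ∀ (G₀ : E4 → E4 →L[ℝ] E4 →L[ℝ] ℝ) (f : E4 → ℝ) (e : E4) (S : Set E4) (μ : ℝ),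
      IsCompact S → 0 < μ →
      (∃ U : Set E4, IsOpen U ∧ S ⊆ U ∧ ContDiffOn ℝ 1 G₀ U ∧ ContDiffOn ℝ 2 f U) →
      (∀ x ∈ S, (G₀ x).IsInvertible) →
      (∀ x ∈ S, ∀ w : E4, G₀ x w w = 0 → fderiv ℝ f x w = 0 → G₀ x e w = 0 →
        hessAt G₀ f x w w ≤ -(2 * μ) * ‖w‖ ^ 2) →
      ∃ δ : ℝ, 0 < δ ∧ ∀ x ∈ S, ∀ (G : E4 → E4 →L[ℝ] E4 →L[ℝ] ℝ) (e' : E4),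
        ‖G x - G₀ x‖ ≤ δ → ‖fderiv ℝ G x - fderiv ℝ G₀ x‖ ≤ δ → ‖e' - e‖ ≤ δ →
        ∀ w : E4, G x w w = 0 → fderiv ℝ f x w = 0 → G x e' w = 0 →
          hessAt G f x w w ≤ -μ * ‖w‖ ^ 2 := by
  intro G₀ f e S μ hS hμ hU hinv hmargin
  obtain ⟨U, hU, hSU, hG₀, hf⟩ := hU
  -- the "good" implication holds near `(z, 0)` for every `z ∈ S × sphere`
  have hnhds : ∀ z ∈ S ×ˢ Metric.sphere (0 : E4) 1,
      ∀ᶠ p in 𝓝 ((z, 0) : (E4 × E4) ×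
            (((E4 →L[ℝ] E4 →L[ℝ] ℝ) × (E4 →L[ℝ] E4 →L[ℝ] E4 →L[ℝ] ℝ)) × E4)),
      (G₀ p.1.1 + p.2.1.1) p.1.2 p.1.2 = 0 → fderiv ℝ f p.1.1 p.1.2 = 0 →
      (G₀ p.1.1 + p.2.1.1) (e + p.2.2) p.1.2 = 0 →
      fderiv ℝ (fderiv ℝ f) p.1.1 p.1.2 p.1.2 - fderiv ℝ f p.1.1 ((2⁻¹ : ℝ) •
        (G₀ p.1.1 + p.2.1.1).inverse (koszulOp (fderiv ℝ G₀ p.1.1 + p.2.1.2) p.1.2 p.1.2))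
        ≤ -μ := by
    rintro ⟨x, v⟩ ⟨hx, hv⟩
    refine hessMarginStableLin_eventually hU hG₀ hf (hSU hx) (hinv x hx) v fun h1 h2 h3 => ?_
    have h := hmargin x hx v h1 h2 h3
    rw [mem_sphere_zero_iff_norm.1 hv] at h
    linarith
  obtain ⟨δ, hδ, hgood⟩ :=
    hessMarginStableLin_tube (hS.prod (isCompact_sphere (0 : E4) 1)) hnhds
  refine ⟨δ, hδ, fun x hx G e' hG hdG he w hGw hfw hGe => ?_⟩
  by_cases hw : w = 0
  · subst hw
    simp
  -- normalise `w` and apply the tube at the perturbation `((G x - G₀ x, DG(x) - DG₀(x)), e' - e)`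
  have hn : 0 < ‖w‖ := norm_pos_iff.2 hw
  have hv1 : ‖‖w‖⁻¹ • w‖ = 1 := by
    rw [norm_smul, norm_inv, norm_norm, inv_mul_cancel₀ hn.ne']
  have key : (G₀ x + (G x - G₀ x)) (‖w‖⁻¹ • w) (‖w‖⁻¹ • w) = 0 →
      fderiv ℝ f x (‖w‖⁻¹ • w) = 0 →
      (G₀ x + (G x - G₀ x)) (e + (e' - e)) (‖w‖⁻¹ • w) = 0 →
      fderiv ℝ (fderiv ℝ f) x (‖w‖⁻¹ • w) (‖w‖⁻¹ • w) - fderiv ℝ f x ((2⁻¹ : ℝ) •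
        (G₀ x + (G x - G₀ x)).inverse (koszulOp (fderiv ℝ G₀ x + (fderiv ℝ G x - fderiv ℝ G₀ x))
          (‖w‖⁻¹ • w) (‖w‖⁻¹ • w))) ≤ -μ :=
    hgood (x, ‖w‖⁻¹ • w) (mk_mem_prod hx (mem_sphere_zero_iff_norm.2 hv1))
      ((G x - G₀ x, fderiv ℝ G x - fderiv ℝ G₀ x), e' - e) (max_le (max_le hG hdG) he)
  rw [add_sub_cancel, add_sub_cancel, add_sub_cancel] at key
  have h1 : G x (‖w‖⁻¹ • w) (‖w‖⁻¹ • w) = 0 := by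
    simp only [map_smul, _root_.smul_apply, hGw, smul_eq_mul, mul_zero]
  have h2 : fderiv ℝ f x (‖w‖⁻¹ • w) = 0 := by
    simp only [map_smul, hfw, smul_eq_mul, mul_zero]
  have h3 : G x e' (‖w‖⁻¹ • w) = 0 := by
    simp only [map_smul, hGe, smul_eq_mul, mul_zero]
  have h4 : hessAt G f x (‖w‖⁻¹ • w) (‖w‖⁻¹ • w) ≤ -μ := by
    rw [hessAt_apply, chrAt_apply]
    exact key h1 h2 h3
  have h5 : hessAt G f x (‖w‖⁻¹ • w) (‖w‖⁻¹ • w) = ‖w‖⁻¹ * (‖w‖⁻¹ * hessAt G f x w w) := by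
    simp only [map_smul, _root_.smul_apply, smul_eq_mul]
  have h6 : hessAt G f x w w = ‖w‖ ^ 2 * hessAt G f x (‖w‖⁻¹ • w) (‖w‖⁻¹ • w) := by
    rw [h5]
    field_simp
  calc hessAt G f x w w = ‖w‖ ^ 2 * hessAt G f x (‖w‖⁻¹ • w) (‖w‖⁻¹ • w) := h6
    _ ≤ ‖w‖ ^ 2 * (-μ) := by gcongr
    _ = -μ * ‖w‖ ^ 2 := by ring

end Summit.FinalStateConjecture.FinalStateConjecture.Theorems

end
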